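import Literature.NumberTheory.LFunctions.GaussianCosetThetaMellin
import Literature.NumberTheory.LFunctions.GaussianHeckeConvexity
import HarnessLib

/-!
# Coset zeta functions of `ℤ[i]`: the dual series, the functional equation and uniform polynomial bounds

Topic `Literature/NumberTheory/LFunctions`, sequel to `GaussianCosetThetaMellin.lean` (`cosetPair`,
`cosetZeta M c k` = the continuation of `Z_k(s; c, M) = ∑_{z ≡ c (M), z ≠ 0} z^k N(z)^{-s}`,
`cosetZetaH`), after the model `GaussianHeckeConvexity.lean` (the case `M = 1`). Everything is
PROVED; no named facts.

**Purpose.** The Hecke `L`-functions of `ℚ(i)` to a modulus `M = 4d` with Grössencharakter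
`(z/|z|)^k`, `L(s, ψ) = ∑_{z primary} χ(z) (z/|z|)^k N(z)^{-s} = ∑_c χ(c) Z_k(s + k/2; c, M)`, need,
in §16 of Friedlander–Iwaniec (Ann. of Math. 148 (1998)), "crude but sufficient upper bounds"
(16.18) `L(s, ψ) ≪ (d(|s| + |m|))^{1-σ} (log(4d(|s|+|m|)))²` in `1/2 ≤ σ ≤ 1` — obtained there from
Hecke's functional equation and the Phragmén–Lindelöf principle. Any bound polynomial in `d`, `|k|`,
`|t|` suffices for their argument. This file proves such bounds for the building blocks, UNIFORMLY
in the modulus `M ≥ 1`, the coset `c` and the weight `k`: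

* `dualCosetZeta M c k` — the continuation of the dual series
  `Ẑ_k(s; c, M) = ∑_{y ≠ 0} e(Re(y c̄)/M) y^k N(y)^{-s}` (`Λ` of the symmetric pair), with its
  Dirichlet series for `Re s > k/2 + 1` (`hasSum_dualCosetZeta`);
* `cosetL M c k w = Z_k(w + k/2; c, M)` (natural variable: `∑ (z/|z|)^k N(z)^{-w}`), `dualL`;
  Dirichlet bounds `‖L_c(w)‖, ‖L̂_c(w)‖ ≤ ∑_{x ∈ ℤ[i]} N(x)^{-Re w}` for `Re w > 1`
  (`norm_cosetL_le_normSum`, `norm_dualL_le_normSum`), `≤ normSum(3/2)` for `Re w ≥ 3/2`;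
* **the functional equation** `cosetZeta_fe`:
  `Z_k(k+1-s; c, M) = (-i)^k M⁻¹ (π/M)^{k+1-s} (π/M)^{-s} Γ(s)/Γ(k+1-s) · Ẑ_k(s; c, M)` (Mathlib's
  `WeakFEPair.functional_equation` for `cosetPair`);
* **the left edge** `norm_cosetL_le_of_re_eq_neg_half`: for `Re w = -1/2` (all `k`),
  `‖L_c(w)‖ ≤ M π⁻² normSum(3/2) ‖(k/2+1) + w‖²` (`‖Γ(z̄ + 2)/Γ(z)‖ = ‖z(z+1)‖` exactly; the powers
  of `π/M` contribute `(M/π)²`, the root number `1/M`);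
* `cosetZetaE M c` — for `k = 0`, the ENTIRE function `E_c(w) = (w - 1) Z_0(w; c, M)`
  (`cosetZetaE_eq`, `cosetZetaE_one : E_c(1) = π/M²`, `differentiable_cosetZetaE`);
* finite order in the strip `-1/2 ≤ Re w ≤ 5/2` (`exists_norm_cosetL_le_exp` for `k ≥ 1`,
  `exists_norm_cosetZetaE_le_exp`; `Λ₀` bounded in vertical strips and `‖Γ⁻¹‖ ≤ A e^{c‖u‖²}` from
  the tree's `NumberField.weakFEPair_exists_norm_Λ₀_le`, `exists_norm_inv_Gamma_le_of_abs_re_le`);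
* **the convexity bounds** (Rademacher's Phragmén–Lindelöf theorem,
  `Literature.Analysis.Complex.rademacher_phragmenLindelof_of_finiteOrder`):
  `norm_cosetL_le_mul_sq` — `‖L_c(w)‖ ≤ M · normSum(3/2) · ‖(k/2 + 1) + w‖²` for `k ≥ 1`,
  `Re w ≥ -1/2`; `norm_cosetZetaE_le` — `‖E_c(w)‖ ≤ M · normSum(3/2) · ‖2 + w‖³` for
  `Re w ≥ -1/2`; packaged with an absolute constant in `exists_coset_bounds`.

## References

* E. Hecke, *Eine neue Art von Zetafunktionen und ihre Beziehungen zur Verteilung der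
  Primzahlen. II*, Math. Z. 6 (1920), 11–51, §9. [HeckeMathZ1920]
* H. Rademacher, *On the Phragmén–Lindelöf theorem and some applications*, Math. Z. 72 (1959),
  Thm 2. [Rademacher1959]
* J. Friedlander, H. Iwaniec, *The polynomial `X² + Y⁴` captures its primes*, Ann. of Math. (2)
  148 (1998), 945–1040, §16 (16.18)–(16.19) (the consumer). [FriedlanderIwaniecAnnals1998]

## Mathlib / tree

Mathlib: `WeakFEPair.functional_equation`, `WeakFEPair.symm`, `IsStrongFEPair.symm`,
`hasSum_mellin_pi_mul₀`, `Complex.Gamma_conj`, `Complex.Gamma_add_one`, `Complex.Gamma_ne_zero`,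
`Complex.Gamma_zero`, `Complex.norm_cpow_eq_rpow_re_of_pos`, `tsum_comp_le_tsum_of_inj`.
Tree: `GaussianCosetTheta.cosetPair`, `cosetZeta`, `cosetZetaH`, `cosetZetaH_eq`, `cosetZetaH_one`,
`hasSum_cosetZeta`, `ofReal_div_cpow`, `isStrongFEPair_cosetPair` (`GaussianCosetThetaMellin`);
`GaussianHecke.normSum_pos`, `normSum_anti`, `normSum_term_nonneg`, `summable_norm_pow_div_rpow`
(`GaussianHeckeConvexity`, `GaussianHeckeThetaMellin`); `GaussianTheta.summable_norm_rpow_neg`,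
`norm_toComplex` (`GaussianThetaSeries`); `NumberField.weakFEPair_exists_norm_Λ₀_le`,
`exists_norm_inv_Gamma_le_of_abs_re_le`, `mul_sq_le_cube_add` (`DedekindZetaFiniteOrderProofs`).
-/

noncomputable section

open Complex Real Filter Topology Asymptotics Set MeasureTheory
open scoped Nat

namespace Literature.NumberTheory.LFunctions

namespace GaussianCosetTheta

local notation "ℤ[i]" => GaussianInt

open GaussianHecke (norm_cast_real norm_ofReal_exp)

variable {M : ℕ} [NeZero M] {c : ℤ[i]}


/-! ### The dual coset zeta function `Ẑ_k(s; c, M) = ∑_{y ≠ 0} e(Re(y c̄)/M) y^k N(y)^{-s}` -/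

/-- For `u > 0`: the dual theta series with the `y = 0` term removed, in the normalisation of
`hasSum_mellin_pi_mul₀` (`p y = N(y)/M`, `a y = e(Re(y c̄)/M) y^k`). [folklore] -/
theorem hasSum_dualThetaTerm_sub (k : ℕ) {u : ℝ} (hu : 0 < u) :
    HasSum (fun y : ℤ[i] ↦ if (y.norm : ℝ) / M = 0 then 0
        else (addChar M c y * (y : ℂ) ^ k) * rexp (-π * ((y.norm : ℝ) / M) * u))
      (dualTheta M c k u - dualTheta₀ k) := by
  have h1 : HasSum (fun y : ℤ[i] ↦ dualThetaTerm M c k u y - if y = 0 then dualThetaTerm M c k u 0 else 0)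
      (dualTheta M c k u - dualThetaTerm M c k u 0) := (hasSum_dualTheta k hu).sub (hasSum_ite_eq 0 _)
  rw [dualTheta₀, ← dualThetaTerm_zero (M := M) (c := c) k u]
  refine h1.congr_fun fun y ↦ ?_
  have hN : ((y.norm : ℝ) / M = 0) ↔ y = 0 := by
    rw [div_eq_zero_iff, or_iff_left (M_pos M).ne', Int.cast_eq_zero, GaussianInt.norm_eq_zero]
  by_cases hy : y = 0
  · rw [if_pos (hN.mpr hy), hy, if_pos rfl, sub_self]
  · rw [if_neg (hN.not.mpr hy), if_neg hy, sub_zero, dualThetaTerm]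
    push_cast
    ring_nf

/-- `‖e(·) y^k‖ / (N(y)/M)^σ` is summable over `ℤ[i]` for `σ > k/2 + 1`. [folklore] -/
theorem summable_norm_addChar_pow_div_rpow (k : ℕ) {σ : ℝ} (hσ : (k : ℝ) / 2 + 1 < σ) :
    Summable fun y : ℤ[i] ↦ ‖addChar M c y * (y : ℂ) ^ k‖ / ((y.norm : ℝ) / M) ^ σ := by
  have hM := M_pos M
  have h0 : Summable fun x : ℤ[i] ↦ ‖(x : ℂ) ^ k‖ / (x.norm : ℝ) ^ σ :=
    GaussianHecke.summable_norm_pow_div_rpow k hσ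
  refine (h0.mul_left ((M : ℝ) ^ σ)).congr fun y ↦ ?_
  have hN : (0 : ℝ) ≤ (y.norm : ℝ) := by exact_mod_cast GaussianInt.norm_nonneg _
  rw [norm_mul, norm_addChar, one_mul, Real.div_rpow hN hM.le]
  field_simp

/-- **Mellin transform of `Θ̂_k - [k = 0]`**: for `Re s > k/2 + 1`,
`∫₀^∞ (Θ̂_k(u; c, M) - [k=0]) u^{s-1} du = π^{-s} Γ(s) ∑_{y ≠ 0} e(Re(y c̄)/M) y^k (N(y)/M)^{-s}`.
[folklore] -/
theorem hasSum_mellin_dualTheta_sub (k : ℕ) {s : ℂ} (hs : (k : ℝ) / 2 + 1 < s.re) :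
    HasSum (fun y : ℤ[i] ↦ (π : ℂ) ^ (-s) * Complex.Gamma s * (addChar M c y * (y : ℂ) ^ k) /
        ((((y.norm : ℝ) / M : ℝ)) : ℂ) ^ s)
      (mellin (fun u ↦ dualTheta M c k u - dualTheta₀ k) s) := by
  have hs0 : 0 < s.re := by
    have : (0 : ℝ) ≤ (k : ℝ) / 2 := by positivity
    linarith
  exact hasSum_mellin_pi_mul₀ (fun y ↦ div_nonneg (by exact_mod_cast GaussianInt.norm_nonneg _) (M_pos M).le)
    hs0 (fun u hu ↦ hasSum_dualThetaTerm_sub k hu) (summable_norm_addChar_pow_div_rpow k hs)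

/-- `Λ̂(s) = ∫₀^∞ (Θ̂_k(u; c, M) - [k=0]) u^{s-1} du` whenever `Re s > k/2 + 1` (`Λ̂` = `Λ` of the
symmetric pair). [folklore] -/
theorem cosetPair_symm_Λ_eq_mellin (k : ℕ) {s : ℂ} (hs : (k : ℝ) / 2 + 1 < s.re) :
    (cosetPair M c k).symm.Λ s = mellin (fun u ↦ dualTheta M c k u - dualTheta₀ k) s := by
  rcases Nat.eq_zero_or_pos k with rfl | hk
  · have hk1 : (cosetPair M c 0).symm.k < s.re := by
      show ((0 : ℕ) : ℝ) + 1 < s.re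
      norm_num at hs ⊢
      exact hs
    exact ((cosetPair M c 0).symm.hasMellin hk1).2.symm
  · have hS := (isStrongFEPair_cosetPair (M := M) (c := c) hk.ne').symm
    have h0 : dualTheta₀ k = 0 := by simp [dualTheta₀, hk.ne']
    simp only [h0, sub_zero]
    have := (hS.hasMellin s).2.symm
    simpa [cosetPair, WeakFEPair.symm] using this

variable (M c) in
/-- **The continued dual coset zeta function** `Ẑ_k(s; c, M) = (π/M)^s Γ(s)⁻¹ Λ̂(s)`; for
`Re s > k/2 + 1` it equals `∑_{y ≠ 0} e(Re(y c̄)/M) y^k N(y)^{-s}` (`hasSum_dualCosetZeta`).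
[cite: HeckeMathZ1920, §9] -/
def dualCosetZeta (k : ℕ) (s : ℂ) : ℂ :=
  (((π / M : ℝ)) : ℂ) ^ s * (Complex.Gamma s)⁻¹ * (cosetPair M c k).symm.Λ s

/-- **`Ẑ_k(s; c, M) = ∑_{y ≠ 0} e(Re(y c̄)/M) y^k N(y)^{-s}` for `Re s > k/2 + 1`.**
[cite: HeckeMathZ1920, §9] -/
theorem hasSum_dualCosetZeta (k : ℕ) {s : ℂ} (hs : (k : ℝ) / 2 + 1 < s.re) :
    HasSum (fun y : ℤ[i] ↦ if y = 0 then 0 else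
      addChar M c y * (y : ℂ) ^ k / (((y.norm : ℝ)) : ℂ) ^ s) (dualCosetZeta M c k s) := by
  have hM := M_pos M
  have hs0 : 0 < s.re := by
    have : (0 : ℝ) ≤ (k : ℝ) / 2 := by positivity
    linarith
  have hsne : s ≠ 0 := fun h ↦ by rw [h, zero_re] at hs0; exact lt_irrefl _ hs0
  have hπM : (((π / M : ℝ)) : ℂ) ≠ 0 := ofReal_ne_zero.mpr (div_pos pi_pos hM).ne'
  have hΓ : Complex.Gamma s ≠ 0 := Complex.Gamma_ne_zero_of_re_pos hs0
  have hMc : (((M : ℝ)) : ℂ) ^ s ≠ 0 := by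
    rw [Ne, cpow_eq_zero_iff]; exact fun h ↦ (ofReal_ne_zero.mpr hM.ne') h.1
  have h := hasSum_mellin_dualTheta_sub (M := M) (c := c) k hs
  rw [← cosetPair_symm_Λ_eq_mellin k hs] at h
  have h2 := h.mul_left ((((π / M : ℝ)) : ℂ) ^ s * (Complex.Gamma s)⁻¹)
  refine h2.congr_fun fun y ↦ ?_
  have hπ' : (((π / M : ℝ)) : ℂ) ^ s = (π : ℂ) ^ s / (((M : ℝ)) : ℂ) ^ s := ofReal_div_cpow pi_pos.le s
  have hN0 : (0 : ℝ) ≤ (y.norm : ℝ) := by exact_mod_cast GaussianInt.norm_nonneg _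
  rw [ofReal_div_cpow hN0 s]
  by_cases hy : y = 0
  · rw [if_pos hy, hy]
    simp [Complex.zero_cpow hsne]
  · rw [if_neg hy, hπ', cpow_neg]
    have hπs : (π : ℂ) ^ s ≠ 0 := by
      rw [Ne, cpow_eq_zero_iff]; exact fun h ↦ (ofReal_ne_zero.mpr pi_pos.ne') h.1
    field_simp

/-! ### Dirichlet-series bounds (right half-plane), uniform in `M`, `c`, `k` -/

/-- `|z|^k = N(z)^{k/2}`: `‖(z : ℂ)^k‖ = N(z)^{k/2}`. [folklore] -/
theorem norm_toComplex_pow (z : ℤ[i]) (k : ℕ) :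
    ‖(z : ℂ) ^ k‖ = (((z.norm : ℤ) : ℝ)) ^ ((k : ℝ) / 2) := by
  have hN0 : (0 : ℝ) ≤ ((z.norm : ℤ) : ℝ) := by exact_mod_cast GaussianInt.norm_nonneg z
  rw [norm_pow, GaussianTheta.norm_toComplex, ← Real.rpow_natCast, ← Real.rpow_mul hN0]
  congr 1
  ring

/-- The norm of a summand in the natural variable: for `z ≠ 0` and a unimodular weight `ρ`,
`‖ρ z^k / N(z)^{w + k/2}‖ ≤ N(z)^{-Re w}`. [folklore] -/
theorem norm_term_natural_le {ρ : ℂ} (hρ : ‖ρ‖ ≤ 1) (k : ℕ) (w : ℂ) (z : ℤ[i])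
    (hz : z ≠ 0) :
    ‖ρ * (z : ℂ) ^ k / (((z.norm : ℝ)) : ℂ) ^ (w + (k : ℂ) / 2)‖ ≤ ((z.norm : ℤ) : ℝ) ^ (-w.re) := by
  have hN : (0 : ℝ) < ((z.norm : ℤ) : ℝ) := by exact_mod_cast GaussianInt.norm_pos.mpr hz
  have hcast : (((z.norm : ℝ)) : ℂ) = ((((z.norm : ℤ) : ℝ) : ℝ) : ℂ) := by norm_cast
  rw [norm_div, norm_mul, norm_toComplex_pow, hcast, Complex.norm_cpow_eq_rpow_re_of_pos hN]
  have hre : (w + (k : ℂ) / 2).re = w.re + (k : ℝ) / 2 := by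
    simp [add_re]
  rw [hre, Real.rpow_add hN, Real.rpow_neg hN.le]
  have hk0 : 0 < ((z.norm : ℤ) : ℝ) ^ ((k : ℝ) / 2) := Real.rpow_pos_of_pos hN _
  have hw0 : 0 < ((z.norm : ℤ) : ℝ) ^ w.re := Real.rpow_pos_of_pos hN _
  rw [div_le_iff₀ (mul_pos hw0 hk0)]
  calc ‖ρ‖ * ((z.norm : ℤ) : ℝ) ^ ((k : ℝ) / 2)
      ≤ 1 * ((z.norm : ℤ) : ℝ) ^ ((k : ℝ) / 2) := by gcongr
    _ = (((z.norm : ℤ) : ℝ) ^ w.re)⁻¹ * (((z.norm : ℤ) : ℝ) ^ w.re * ((z.norm : ℤ) : ℝ) ^ ((k : ℝ) / 2)) := by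
        field_simp

variable (M c) in
/-- **The coset zeta function in the natural variable**: `L_c(w) = Z_k(w + k/2; c, M)
= ∑_{z ≡ c, z ≠ 0} (z/|z|)^k N(z)^{-w}` for `Re w > 1`. [cite: HeckeMathZ1920, §9] -/
def cosetL (k : ℕ) (w : ℂ) : ℂ := cosetZeta M c k (w + (k : ℂ) / 2)

variable (M c) in
/-- The dual coset zeta function in the natural variable: `L̂_c(w) = Ẑ_k(w + k/2; c, M)`. [folklore] -/
def dualL (k : ℕ) (w : ℂ) : ℂ := dualCosetZeta M c k (w + (k : ℂ) / 2)

/-- `Re(w + k/2) > k/2 + 1` iff `Re w > 1`. [folklore] -/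
theorem re_add_half (k : ℕ) (w : ℂ) : (w + (k : ℂ) / 2).re = w.re + (k : ℝ) / 2 := by
  simp [add_re]

/-- **`‖L_c(w)‖ ≤ ∑_{z ∈ ℤ[i]} N(z)^{-Re w}` for `Re w > 1`** (all `M`, `c`, `k`). [folklore] -/
theorem norm_cosetL_le_normSum (k : ℕ) {w : ℂ} (hw : 1 < w.re) :
    ‖cosetL M c k w‖ ≤ ∑' x : ℤ[i], ((x.norm : ℤ) : ℝ) ^ (-w.re) := by
  have hs : (k : ℝ) / 2 + 1 < (w + (k : ℂ) / 2).re := by rw [re_add_half]; linarith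
  have hsum := GaussianTheta.summable_norm_rpow_neg hw
  rw [cosetL, ← (hasSum_cosetZeta k hs).tsum_eq]
  have hle : ∀ y : ℤ[i], ‖(if pt M c y = 0 then 0 else
      ((pt M c y : ℤ[i]) : ℂ) ^ k / ((((pt M c y).norm : ℝ)) : ℂ) ^ (w + (k : ℂ) / 2))‖ ≤
      (((pt M c y).norm : ℤ) : ℝ) ^ (-w.re) := by
    intro y
    by_cases hy : pt M c y = 0
    · rw [if_pos hy, norm_zero]; exact GaussianHecke.normSum_term_nonneg _ _
    · rw [if_neg hy]
      have := norm_term_natural_le (ρ := 1) (by simp) k w (pt M c y) hy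
      rwa [one_mul] at this
  have hsub : Summable fun y : ℤ[i] ↦ (((pt M c y).norm : ℤ) : ℝ) ^ (-w.re) :=
    hsum.comp_injective (pt_injective M c)
  calc ‖∑' y : ℤ[i], (if pt M c y = 0 then 0 else
        ((pt M c y : ℤ[i]) : ℂ) ^ k / ((((pt M c y).norm : ℝ)) : ℂ) ^ (w + (k : ℂ) / 2))‖
      ≤ ∑' y : ℤ[i], (((pt M c y).norm : ℤ) : ℝ) ^ (-w.re) := tsum_of_norm_bounded hsub.hasSum hle
    _ ≤ ∑' x : ℤ[i], ((x.norm : ℤ) : ℝ) ^ (-w.re) :=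
        tsum_comp_le_tsum_of_inj hsum (fun x ↦ GaussianHecke.normSum_term_nonneg _ x) (pt_injective M c)

/-- **`‖L̂_c(w)‖ ≤ ∑_{z ∈ ℤ[i]} N(z)^{-Re w}` for `Re w > 1`** (all `M`, `c`, `k`). [folklore] -/
theorem norm_dualL_le_normSum (k : ℕ) {w : ℂ} (hw : 1 < w.re) :
    ‖dualL M c k w‖ ≤ ∑' x : ℤ[i], ((x.norm : ℤ) : ℝ) ^ (-w.re) := by
  have hs : (k : ℝ) / 2 + 1 < (w + (k : ℂ) / 2).re := by rw [re_add_half]; linarith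
  have hsum := GaussianTheta.summable_norm_rpow_neg hw
  rw [dualL, ← (hasSum_dualCosetZeta k hs).tsum_eq]
  refine tsum_of_norm_bounded hsum.hasSum fun y ↦ ?_
  by_cases hy : y = 0
  · rw [if_pos hy, norm_zero]; exact GaussianHecke.normSum_term_nonneg _ y
  · rw [if_neg hy]
    exact norm_term_natural_le (le_of_eq (norm_addChar M c y)) k w y hy

/-- `‖L_c(w)‖ ≤ normSum (3/2)` for `Re w ≥ 3/2`. [folklore] -/
theorem norm_cosetL_le_of_le_re (k : ℕ) {w : ℂ} (hw : 3 / 2 ≤ w.re) :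
    ‖cosetL M c k w‖ ≤ ∑' x : ℤ[i], ((x.norm : ℤ) : ℝ) ^ (-(3 / 2 : ℝ)) :=
  (norm_cosetL_le_normSum k (by linarith)).trans (GaussianHecke.normSum_anti (by norm_num) hw)

/-- `‖L̂_c(w)‖ ≤ normSum (3/2)` for `Re w ≥ 3/2`. [folklore] -/
theorem norm_dualL_le_of_le_re (k : ℕ) {w : ℂ} (hw : 3 / 2 ≤ w.re) :
    ‖dualL M c k w‖ ≤ ∑' x : ℤ[i], ((x.norm : ℤ) : ℝ) ^ (-(3 / 2 : ℝ)) :=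
  (norm_dualL_le_normSum k (by linarith)).trans (GaussianHecke.normSum_anti (by norm_num) hw)

/-! ### The functional equation `Z_k(k + 1 - s; c, M) ↔ Ẑ_k(s; c, M)` -/

/-- The weight of the FE-pair of a coset, as a complex number: `k + 1`. [folklore] -/
theorem cosetPair_k_cast (k : ℕ) : (((cosetPair M c k).k : ℝ) : ℂ) = (k : ℂ) + 1 := by
  show (((k : ℝ) + 1 : ℝ) : ℂ) = (k : ℂ) + 1
  push_cast
  ring

/-- The root number of the FE-pair of a coset: `(-i)^k / M`. [folklore] -/
theorem cosetPair_ε (k : ℕ) : (cosetPair M c k).ε = (-I) ^ k * ((M : ℂ))⁻¹ := rfl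

/-- For `k ≥ 1`, `Λ = Λ₀` (no constant terms). [folklore] -/
theorem cosetPair_Λ_eq_Λ₀ {k : ℕ} (hk : k ≠ 0) (w : ℂ) : (cosetPair M c k).Λ w = (cosetPair M c k).Λ₀ w := by
  have hf : (cosetPair M c k).f₀ = 0 := by simp [cosetPair, theta₀, hk]
  have hg : (cosetPair M c k).g₀ = 0 := by simp [cosetPair, dualTheta₀, hk]
  rw [WeakFEPair.Λ, hf, hg, smul_zero, smul_zero, sub_zero, sub_zero]

/-- **The functional equation of the coset zeta functions** (Hecke 1920, §9): whenever `Γ(s) ≠ 0`,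
`Z_k(k + 1 - s; c, M) = (-i)^k M⁻¹ (π/M)^{k+1-s} (π/M)^{-s} · Γ(s)/Γ(k+1-s) · Ẑ_k(s; c, M)`, i.e.
`(π/M)^{-(k+1-s)} Γ(k+1-s) Z_k(k+1-s; c, M) = (-i)^k M⁻¹ (π/M)^{-s} Γ(s) Ẑ_k(s; c, M)`.
[cite: HeckeMathZ1920, §9] -/
theorem cosetZeta_fe (k : ℕ) {s : ℂ} (hΓ : Complex.Gamma s ≠ 0) :
    cosetZeta M c k ((k : ℂ) + 1 - s) =
      (-I) ^ k * ((M : ℂ))⁻¹ * (((π / M : ℝ)) : ℂ) ^ ((k : ℂ) + 1 - s) *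
        ((((π / M : ℝ)) : ℂ) ^ s)⁻¹ * (Complex.Gamma s / Complex.Gamma ((k : ℂ) + 1 - s)) *
          dualCosetZeta M c k s := by
  have hA : (((π / M : ℝ)) : ℂ) ≠ 0 := ofReal_ne_zero.mpr (div_pos pi_pos (M_pos M)).ne'
  have hAs : (((π / M : ℝ)) : ℂ) ^ s ≠ 0 := by
    rw [Ne, cpow_eq_zero_iff]; exact fun h ↦ hA h.1
  have hfe := (cosetPair M c k).functional_equation s
  rw [cosetPair_k_cast, cosetPair_ε, smul_eq_mul] at hfe
  unfold cosetZeta dualCosetZeta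
  rw [hfe]
  field_simp

/-- `‖Γ(z̄ + 2)‖ = ‖z + 1‖ ‖z‖ ‖Γ(z)‖` for `z ≠ 0, -1` (`Γ(w + 2) = (w + 1) w Γ(w)` and
`Γ(w̄) = Γ(w)‾`). [folklore] -/
theorem norm_Gamma_conj_add_two {z : ℂ} (hz0 : z ≠ 0) (hz1 : z + 1 ≠ 0) :
    ‖Complex.Gamma (starRingEnd ℂ z + 2)‖ = ‖z + 1‖ * ‖z‖ * ‖Complex.Gamma z‖ := by
  have h2 : starRingEnd ℂ z + 2 = starRingEnd ℂ (z + 2) := by rw [map_add, map_ofNat]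
  rw [h2, Complex.Gamma_conj, Complex.norm_conj,
    show z + 2 = (z + 1) + 1 by ring, Complex.Gamma_add_one _ hz1, Complex.Gamma_add_one _ hz0,
    norm_mul, norm_mul, mul_assoc]

/-- `Γ` does not vanish at a point `s'` with `Re s' = k/2 - 1/2` (`k : ℕ`) unless `s' = 0`. [folklore] -/
theorem Gamma_ne_zero_of_re_eq (k : ℕ) {s' : ℂ} (hre : s'.re = (k : ℝ) / 2 - 1 / 2) (hs : s' ≠ 0) :
    Complex.Gamma s' ≠ 0 := by
  refine Complex.Gamma_ne_zero fun m hm ↦ ?_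
  have h1 : s'.re = -(m : ℝ) := by rw [hm]; simp
  have h2 : s'.im = 0 := by rw [hm]; simp
  rw [hre] at h1
  have hk : (k : ℝ) = 1 - 2 * m := by linarith
  have hm0 : m = 0 := by
    by_contra h
    have : (1 : ℝ) ≤ m := by exact_mod_cast Nat.one_le_iff_ne_zero.mpr h
    have : (0 : ℝ) ≤ k := Nat.cast_nonneg k
    linarith
  apply hs
  rw [hm, hm0]
  simp

/-- `‖w‖ ≤ ‖w + 1‖` when `Re w ≥ -1/2`. [folklore] -/
theorem norm_le_norm_add_one {w : ℂ} (hw : -1 / 2 ≤ w.re) : ‖w‖ ≤ ‖w + 1‖ := by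
  have h1 : ‖w‖ ^ 2 ≤ ‖w + 1‖ ^ 2 := by
    rw [Complex.sq_norm, Complex.sq_norm, Complex.normSq_apply, Complex.normSq_apply]
    simp; nlinarith
  exact (sq_le_sq₀ (norm_nonneg _) (norm_nonneg _)).mp h1

/-- **The left edge.** For `Re w = -1/2` (all `k`, `M`, `c`):
`‖L_c(w)‖ ≤ M π⁻² normSum(3/2) ‖(k/2 + 1) + w‖²` — the functional equation, `‖Γ(z̄+2)/Γ(z)‖ =
‖z(z+1)‖` at `z = w + k/2`, the powers of `π/M` contributing `(M/π)²`, `|ε| = 1/M`, and the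
Dirichlet-series bound for the dual function at `Re = 3/2`. [cite: HeckeMathZ1920, §9] -/
theorem norm_cosetL_le_of_re_eq_neg_half (k : ℕ) {w : ℂ} (hw : w.re = -1 / 2) :
    ‖cosetL M c k w‖ ≤
      ((M : ℝ) * (π⁻¹ ^ 2 * ∑' x : ℤ[i], ((x.norm : ℤ) : ℝ) ^ (-(3 / 2 : ℝ)))) *
        ‖((k : ℂ) / 2 + 1) + w‖ ^ 2 := by
  have hM := M_pos M
  set nS : ℝ := ∑' x : ℤ[i], ((x.norm : ℤ) : ℝ) ^ (-(3 / 2 : ℝ)) with hnS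
  have hnS0 : 0 < nS := GaussianHecke.normSum_pos (by norm_num)
  set s' : ℂ := w + (k : ℂ) / 2 with hs'def
  have hcos : cosetL M c k w = cosetZeta M c k s' := rfl
  have hs're : s'.re = (k : ℝ) / 2 - 1 / 2 := by rw [hs'def, re_add_half, hw]; ring
  have hQ : ((k : ℂ) / 2 + 1) + w = s' + 1 := by rw [hs'def]; ring
  rw [hcos, hQ]
  by_cases hs'0 : s' = 0
  · -- `Z_k(0) = (π/M)^0 Γ(0)⁻¹ Λ(0) = 0`
    have : cosetZeta M c k s' = 0 := by
      rw [cosetZeta, hs'0, Complex.Gamma_zero, inv_zero, mul_zero, zero_mul]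
    rw [this, norm_zero]
    positivity
  -- the reflected point
  set s : ℂ := (k : ℂ) + 1 - s' with hsdef
  have hss' : s' = (k : ℂ) + 1 - s := by rw [hsdef]; ring
  have hsre : s.re = (k : ℝ) / 2 + 3 / 2 := by
    rw [hsdef, sub_re, hs're]; simp; ring
  have hsre0 : 0 < s.re := by rw [hsre]; positivity
  have hΓs : Complex.Gamma s ≠ 0 := Complex.Gamma_ne_zero_of_re_pos hsre0
  have hΓs' : Complex.Gamma s' ≠ 0 := Gamma_ne_zero_of_re_eq k hs're hs'0
  have hconj : s = starRingEnd ℂ s' + 2 := by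
    apply Complex.ext
    · rw [hsre]; simp [hs're]; ring
    · rw [hsdef]; simp
  have hs'1 : s' + 1 ≠ 0 := fun h ↦ by
    have := congrArg Complex.re h
    rw [add_re, one_re, hs're, zero_re] at this
    have : (0 : ℝ) ≤ k := Nat.cast_nonneg k
    linarith
  have hFE := cosetZeta_fe (M := M) (c := c) k hΓs
  rw [← hss'] at hFE
  -- norms of the factors
  have hA : (0 : ℝ) < π / M := div_pos pi_pos hM
  have hn0 : ‖((-I) ^ k : ℂ)‖ = 1 := by rw [norm_pow, norm_neg, Complex.norm_I, one_pow]
  have hn1 : ‖(((M : ℂ))⁻¹ : ℂ)‖ = (M : ℝ)⁻¹ := by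
    rw [norm_inv]; simp
  have hn2 : ‖(((π / M : ℝ)) : ℂ) ^ s'‖ = (π / M) ^ ((k : ℝ) / 2 - 1 / 2) := by
    rw [Complex.norm_cpow_eq_rpow_re_of_pos hA, hs're]
  have hn3 : ‖((((π / M : ℝ)) : ℂ) ^ s)⁻¹‖ = (π / M) ^ (-((k : ℝ) / 2 + 3 / 2)) := by
    rw [norm_inv, Complex.norm_cpow_eq_rpow_re_of_pos hA, ← Real.rpow_neg hA.le, hsre]
  have hn4 : ‖Complex.Gamma s / Complex.Gamma s'‖ = ‖s' + 1‖ * ‖s'‖ := by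
    rw [hconj, norm_div, norm_Gamma_conj_add_two hs'0 hs'1, mul_div_assoc,
      div_self (norm_ne_zero_iff.mpr hΓs'), mul_one]
  have hn5 : ‖dualCosetZeta M c k s‖ ≤ nS := by
    have : dualCosetZeta M c k s = dualL M c k (s - (k : ℂ) / 2) := by
      rw [dualL]; congr 1; ring
    rw [this]
    exact norm_dualL_le_of_le_re k (by rw [sub_re, hsre]; simp)
  have hAA : (π / M) ^ ((k : ℝ) / 2 - 1 / 2) * (π / M) ^ (-((k : ℝ) / 2 + 3 / 2)) = (M : ℝ) ^ 2 * π⁻¹ ^ 2 := by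
    rw [← Real.rpow_add hA, show (k : ℝ) / 2 - 1 / 2 + -((k : ℝ) / 2 + 3 / 2) = -2 by ring,
      Real.rpow_neg hA.le, Real.rpow_two]
    field_simp
  have hww : ‖s'‖ ≤ ‖s' + 1‖ := norm_le_norm_add_one (by rw [hs're]; linarith [(Nat.cast_nonneg k : (0:ℝ) ≤ k)])
  calc ‖cosetZeta M c k s'‖
      = ‖((-I) ^ k : ℂ)‖ * ‖(((M : ℂ))⁻¹ : ℂ)‖ * ‖(((π / M : ℝ)) : ℂ) ^ s'‖ *
          ‖((((π / M : ℝ)) : ℂ) ^ s)⁻¹‖ * ‖Complex.Gamma s / Complex.Gamma s'‖ *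
            ‖dualCosetZeta M c k s‖ := by
        rw [hFE, norm_mul, norm_mul, norm_mul, norm_mul, norm_mul]
    _ = (M : ℝ)⁻¹ * ((M : ℝ) ^ 2 * π⁻¹ ^ 2) * (‖s' + 1‖ * ‖s'‖) * ‖dualCosetZeta M c k s‖ := by
        rw [hn0, hn1, hn4, one_mul, mul_assoc ((M : ℝ)⁻¹), hn2, hn3, hAA]
    _ ≤ (M : ℝ)⁻¹ * ((M : ℝ) ^ 2 * π⁻¹ ^ 2) * (‖s' + 1‖ * ‖s' + 1‖) * nS := by
        gcongr
    _ = ((M : ℝ) * (π⁻¹ ^ 2 * nS)) * ‖s' + 1‖ ^ 2 := by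
        field_simp

/-! ### `k = 0`: the entire function `E_c(w) = (w - 1) Z_0(w; c, M)` -/

variable (M c) in
/-- The entire function `E_c(w) = (π/M)^w ((w - 1) Λ₀(w) Γ(w)⁻¹ - (w - 1) Θ₀ Γ(w + 1)⁻¹ + M⁻¹ Γ(w)⁻¹)`,
equal to `(w - 1) Z_0(w; c, M)` for `w ≠ 0, 1` and to the residue `π/M²` at `w = 1` (it is
`cosetZetaH` with `Γ(w)⁻¹/w` replaced by the entire `Γ(w + 1)⁻¹`). [folklore] -/
def cosetZetaE (w : ℂ) : ℂ :=
  (((π / M : ℝ)) : ℂ) ^ w *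
    ((w - 1) * (cosetPair M c 0).Λ₀ w * (Complex.Gamma w)⁻¹ -
      (w - 1) * theta₀ M c 0 * (Complex.Gamma (w + 1))⁻¹ + ((M : ℂ))⁻¹ * (Complex.Gamma w)⁻¹)

/-- **`E_c` is entire.** [folklore] -/
theorem differentiable_cosetZetaE : Differentiable ℂ (cosetZetaE M c) := by
  have hA : (((π / M : ℝ)) : ℂ) ≠ 0 := ofReal_ne_zero.mpr (div_pos pi_pos (M_pos M)).ne'
  have hΛ₀ := (cosetPair M c 0).differentiable_Λ₀
  have hG : Differentiable ℂ fun w : ℂ ↦ (Complex.Gamma w)⁻¹ := Complex.differentiable_one_div_Gamma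
  have hG1 : Differentiable ℂ fun w : ℂ ↦ (Complex.Gamma (w + 1))⁻¹ :=
    Complex.differentiable_one_div_Gamma.comp (differentiable_id.add_const 1)
  unfold cosetZetaE
  refine (differentiable_id.const_cpow (Or.inl hA)).mul ?_
  refine ((((differentiable_id.sub_const 1).mul hΛ₀).mul hG).sub ?_).add (hG.const_mul _)
  exact ((differentiable_id.sub_const 1).mul_const _).mul hG1

/-- `E_c(w) = H_c(w)` (`cosetZetaH`) for `w ≠ 0`. [folklore] -/
theorem cosetZetaE_eq_cosetZetaH {w : ℂ} (hw0 : w ≠ 0) : cosetZetaE M c w = cosetZetaH M c w := by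
  unfold cosetZetaE cosetZetaH
  rw [Complex.Gamma_add_one _ hw0]
  by_cases hΓ : Complex.Gamma w = 0
  · rw [hΓ]; simp
  · field_simp

/-- **`E_c(w) = (w - 1) Z_0(w; c, M)` for `w ≠ 0, 1`.** [folklore] -/
theorem cosetZetaE_eq {w : ℂ} (hw0 : w ≠ 0) (hw1 : w ≠ 1) :
    cosetZetaE M c w = (w - 1) * cosetZeta M c 0 w := by
  rw [cosetZetaE_eq_cosetZetaH hw0, cosetZetaH_eq hw1]

/-- **`E_c(1) = π/M²`** (the residue of `Z_0(·; c, M)` at `1`). [folklore] -/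
theorem cosetZetaE_one : cosetZetaE M c 1 = π / (M : ℂ) ^ 2 := by
  rw [cosetZetaE_eq_cosetZetaH one_ne_zero, cosetZetaH_one]

/-! ### Finite order in vertical strips -/

/-- `|(π/M)^u| ≤ e^{S |log(π/M)|}` for `|Re u| ≤ S`. [folklore] -/
theorem norm_piDivM_cpow_le {u : ℂ} {S : ℝ} (hu : |u.re| ≤ S) :
    ‖(((π / M : ℝ)) : ℂ) ^ u‖ ≤ Real.exp (S * |Real.log (π / M)|) := by
  have hA : (0 : ℝ) < π / M := div_pos pi_pos (M_pos M)
  rw [Complex.norm_cpow_eq_rpow_re_of_pos hA, Real.rpow_def_of_pos hA, Real.exp_le_exp]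
  calc Real.log (π / M) * u.re ≤ |Real.log (π / M) * u.re| := le_abs_self _
    _ = |Real.log (π / M)| * |u.re| := abs_mul _ _
    _ ≤ |Real.log (π / M)| * S := by gcongr
    _ = S * |Real.log (π / M)| := mul_comm _ _

/-- `x + 1 ≤ e · e^{x²}` for `x ≥ 0`-free: `‖w‖ + 1 ≤ exp 1 * exp (‖w‖²)`. [folklore] -/
theorem norm_add_one_le_exp (w : ℂ) : ‖w‖ + 1 ≤ Real.exp 1 * Real.exp (‖w‖ ^ 2) := by
  have h1 : ‖w‖ + 1 ≤ Real.exp ‖w‖ := Real.add_one_le_exp _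
  have h2 : ‖w‖ ≤ ‖w‖ ^ 2 + 1 := by nlinarith [sq_nonneg (‖w‖ - 1 / 2)]
  calc ‖w‖ + 1 ≤ Real.exp ‖w‖ := h1
    _ ≤ Real.exp (‖w‖ ^ 2 + 1) := Real.exp_le_exp.mpr h2
    _ = Real.exp 1 * Real.exp (‖w‖ ^ 2) := by rw [Real.exp_add]; ring

/-- From `‖u‖² ≤ S² + (Im z)²` and `c t² ≤ |t|³ + c³`: `exp(c ‖u‖²) ≤ exp(c S²) exp(c³) exp(|Im z|³)`.
[folklore] -/
theorem exp_mul_norm_sq_le {u z : ℂ} {S c : ℝ} (hc : 0 ≤ c) (hre : |u.re| ≤ S) (him : u.im = z.im) :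
    Real.exp (c * ‖u‖ ^ 2) ≤ Real.exp (c * S ^ 2) * Real.exp (c ^ 3) * Real.exp (|z.im| ^ (3 : ℝ)) := by
  have h4 : ‖u‖ ^ 2 ≤ S ^ 2 + z.im ^ 2 := by
    rw [Complex.sq_norm, Complex.normSq_apply, him]
    have := (sq_le_sq' (abs_le.mp hre).1 (abs_le.mp hre).2)
    nlinarith
  have h5 : c * z.im ^ 2 ≤ |z.im| ^ (3 : ℝ) + c ^ 3 := by
    have h := NumberField.mul_sq_le_cube_add hc (abs_nonneg z.im)
    rw [sq_abs] at h
    rw [show (3 : ℝ) = ((3 : ℕ) : ℝ) by norm_num, Real.rpow_natCast]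
    exact h
  calc Real.exp (c * ‖u‖ ^ 2) ≤ Real.exp (c * (S ^ 2 + z.im ^ 2)) := by
        apply Real.exp_le_exp.mpr; exact mul_le_mul_of_nonneg_left h4 hc
    _ = Real.exp (c * S ^ 2) * Real.exp (c * z.im ^ 2) := by rw [mul_add, Real.exp_add]
    _ ≤ Real.exp (c * S ^ 2) * Real.exp (|z.im| ^ (3 : ℝ) + c ^ 3) := by gcongr
    _ = Real.exp (c * S ^ 2) * Real.exp (c ^ 3) * Real.exp (|z.im| ^ (3 : ℝ)) := by
        rw [Real.exp_add]; ring

/-- **`L_c` has finite order in the strip `-1/2 ≤ Re w ≤ 5/2`** (`k ≥ 1`): there is `C` with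
`‖L_c(w)‖ ≤ C exp(|Im w|³)` there (`L_c(w) = (π/M)^u Γ(u)⁻¹ Λ₀(u)`, `u = w + k/2`, `Λ₀` bounded in
vertical strips, `‖Γ(u)⁻¹‖ ≤ A e^{c‖u‖²}`). Only the existence of such a bound matters. [folklore] -/
theorem exists_norm_cosetL_le_exp {k : ℕ} (hk : k ≠ 0) :
    ∃ C : ℝ, ∀ w : ℂ, -1 / 2 ≤ w.re → w.re ≤ 5 / 2 →
      ‖cosetL M c k w‖ ≤ C * Real.exp (|w.im| ^ (3 : ℝ)) := by
  set S : ℝ := (k : ℝ) / 2 + 5 / 2 with hSdef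
  have hS0 : 0 ≤ S := by positivity
  obtain ⟨A, c₀, hA, hc₀, hΓ⟩ := NumberField.exists_norm_inv_Gamma_le_of_abs_re_le hS0
  obtain ⟨B, hB0, hB⟩ :=
    NumberField.weakFEPair_exists_norm_Λ₀_le (cosetPair M c k) ((k : ℝ) / 2 - 1 / 2) ((k : ℝ) / 2 + 5 / 2)
  refine ⟨Real.exp (S * |Real.log (π / M)|) * A * Real.exp (c₀ * S ^ 2) * Real.exp (c₀ ^ 3) * B,
    fun w hw1 hw2 ↦ ?_⟩
  have hk0 : (0 : ℝ) ≤ k := Nat.cast_nonneg k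
  set u : ℂ := w + (k : ℂ) / 2 with hudef
  have hure : u.re = w.re + (k : ℝ) / 2 := by rw [hudef, re_add_half]
  have huim : u.im = w.im := by simp [hudef]
  have hcos : cosetL M c k w = (((π / M : ℝ)) : ℂ) ^ u * (Complex.Gamma u)⁻¹ * (cosetPair M c k).Λ₀ u := by
    show cosetZeta M c k u = _
    rw [cosetZeta, cosetPair_Λ_eq_Λ₀ hk]
  have hreS : |u.re| ≤ S := by rw [hure, hSdef, abs_le]; constructor <;> linarith
  have h1 : ‖(((π / M : ℝ)) : ℂ) ^ u‖ ≤ Real.exp (S * |Real.log (π / M)|) := norm_piDivM_cpow_le hreS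
  have h2 : ‖(Complex.Gamma u)⁻¹‖ ≤ A * Real.exp (c₀ * ‖u‖ ^ 2) := hΓ u hreS
  have h3 : ‖(cosetPair M c k).Λ₀ u‖ ≤ B := hB u (by rw [hure]; linarith) (by rw [hure]; linarith)
  have h4 := exp_mul_norm_sq_le hc₀ hreS huim
  calc ‖cosetL M c k w‖
      = ‖(((π / M : ℝ)) : ℂ) ^ u‖ * ‖(Complex.Gamma u)⁻¹‖ * ‖(cosetPair M c k).Λ₀ u‖ := by
        rw [hcos, norm_mul, norm_mul]
    _ ≤ Real.exp (S * |Real.log (π / M)|) * (A * Real.exp (c₀ * ‖u‖ ^ 2)) * B := by gcongr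
    _ ≤ Real.exp (S * |Real.log (π / M)|) *
          (A * (Real.exp (c₀ * S ^ 2) * Real.exp (c₀ ^ 3) * Real.exp (|w.im| ^ (3 : ℝ)))) * B := by gcongr
    _ = Real.exp (S * |Real.log (π / M)|) * A * Real.exp (c₀ * S ^ 2) * Real.exp (c₀ ^ 3) * B *
          Real.exp (|w.im| ^ (3 : ℝ)) := by ring

/-- `‖w + 1‖² ≤ 2 ‖w‖² + 2`. [folklore] -/
theorem norm_add_one_sq_le (w : ℂ) : ‖w + 1‖ ^ 2 ≤ 2 * ‖w‖ ^ 2 + 2 := by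
  have h := norm_add_le w 1
  rw [norm_one] at h
  nlinarith [norm_nonneg w, norm_nonneg (w + 1), sq_nonneg (‖w‖ - 1)]

/-- **`E_c` has finite order in the strip `-1/2 ≤ Re w ≤ 5/2`**: `‖E_c(w)‖ ≤ C exp(|Im w|³)`.
[folklore] -/
theorem exists_norm_cosetZetaE_le_exp :
    ∃ C : ℝ, ∀ w : ℂ, -1 / 2 ≤ w.re → w.re ≤ 5 / 2 →
      ‖cosetZetaE M c w‖ ≤ C * Real.exp (|w.im| ^ (3 : ℝ)) := by
  set S : ℝ := 7 / 2 with hSdef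
  have hS0 : (0 : ℝ) ≤ S := by norm_num
  obtain ⟨A, c₀, hA, hc₀, hΓ⟩ := NumberField.exists_norm_inv_Gamma_le_of_abs_re_le hS0
  obtain ⟨B, hB0, hB⟩ := NumberField.weakFEPair_exists_norm_Λ₀_le (cosetPair M c 0) (-1 / 2) (5 / 2)
  set c₁ : ℝ := 1 + 2 * c₀ with hc₁
  have hc₁0 : 0 ≤ c₁ := by positivity
  set E0 : ℝ := Real.exp (S * |Real.log (π / M)|) with hE0
  set K : ℝ := Real.exp 1 * B * A + Real.exp 1 * ‖theta₀ M c 0‖ * A * Real.exp (2 * c₀) + A with hK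
  refine ⟨E0 * K * (Real.exp (c₁ * S ^ 2) * Real.exp (c₁ ^ 3)), fun w hw1 hw2 ↦ ?_⟩
  have hreS : |w.re| ≤ S := by rw [hSdef, abs_le]; constructor <;> linarith
  have hreS1 : |(w + 1).re| ≤ S := by
    rw [add_re, one_re, hSdef, abs_le]; constructor <;> linarith
  set X : ℝ := Real.exp (c₁ * ‖w‖ ^ 2) with hX
  -- elementary bounds
  have h0 : ‖(((π / M : ℝ)) : ℂ) ^ w‖ ≤ E0 := norm_piDivM_cpow_le hreS
  have h1 : ‖w - 1‖ ≤ Real.exp 1 * Real.exp (‖w‖ ^ 2) := by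
    calc ‖w - 1‖ ≤ ‖w‖ + ‖(1 : ℂ)‖ := norm_sub_le _ _
      _ = ‖w‖ + 1 := by rw [norm_one]
      _ ≤ Real.exp 1 * Real.exp (‖w‖ ^ 2) := norm_add_one_le_exp w
  have h2 : ‖(Complex.Gamma w)⁻¹‖ ≤ A * Real.exp (c₀ * ‖w‖ ^ 2) := hΓ w hreS
  have h3 : ‖(Complex.Gamma (w + 1))⁻¹‖ ≤ A * (Real.exp (2 * c₀) * Real.exp (2 * c₀ * ‖w‖ ^ 2)) := by
    refine (hΓ (w + 1) hreS1).trans ?_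
    rw [← Real.exp_add]
    gcongr
    nlinarith [norm_add_one_sq_le w]
  have h4 : ‖(cosetPair M c 0).Λ₀ w‖ ≤ B := hB w hw1 hw2
  have h5 : ‖(((M : ℂ))⁻¹ : ℂ)‖ ≤ 1 := by
    rw [norm_inv, Complex.norm_natCast]
    exact inv_le_one_of_one_le₀ (by exact_mod_cast Nat.one_le_iff_ne_zero.mpr (NeZero.ne M))
  -- exponentials combine into `X = exp(c₁ ‖w‖²)`
  have hsq : 0 ≤ ‖w‖ ^ 2 := sq_nonneg _
  have e1 : Real.exp (‖w‖ ^ 2) * Real.exp (c₀ * ‖w‖ ^ 2) ≤ X := by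
    rw [← Real.exp_add, hX, Real.exp_le_exp, hc₁]; nlinarith
  have e2 : Real.exp (‖w‖ ^ 2) * Real.exp (2 * c₀ * ‖w‖ ^ 2) ≤ X := by
    rw [← Real.exp_add, hX, Real.exp_le_exp, hc₁]; nlinarith
  have e3 : Real.exp (c₀ * ‖w‖ ^ 2) ≤ X := by
    rw [hX, Real.exp_le_exp, hc₁]; nlinarith
  have hX3 : X ≤ Real.exp (c₁ * S ^ 2) * Real.exp (c₁ ^ 3) * Real.exp (|w.im| ^ (3 : ℝ)) :=
    exp_mul_norm_sq_le hc₁0 hreS rfl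
  -- the three pieces
  have p1 : ‖(w - 1) * (cosetPair M c 0).Λ₀ w * (Complex.Gamma w)⁻¹‖ ≤ Real.exp 1 * B * A * X := by
    rw [norm_mul, norm_mul]
    calc ‖w - 1‖ * ‖(cosetPair M c 0).Λ₀ w‖ * ‖(Complex.Gamma w)⁻¹‖
        ≤ (Real.exp 1 * Real.exp (‖w‖ ^ 2)) * B * (A * Real.exp (c₀ * ‖w‖ ^ 2)) := by gcongr
      _ = Real.exp 1 * B * A * (Real.exp (‖w‖ ^ 2) * Real.exp (c₀ * ‖w‖ ^ 2)) := by ring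
      _ ≤ Real.exp 1 * B * A * X := by gcongr
  have p2 : ‖(w - 1) * theta₀ M c 0 * (Complex.Gamma (w + 1))⁻¹‖ ≤
      Real.exp 1 * ‖theta₀ M c 0‖ * A * Real.exp (2 * c₀) * X := by
    rw [norm_mul, norm_mul]
    calc ‖w - 1‖ * ‖theta₀ M c 0‖ * ‖(Complex.Gamma (w + 1))⁻¹‖
        ≤ (Real.exp 1 * Real.exp (‖w‖ ^ 2)) * ‖theta₀ M c 0‖ *
            (A * (Real.exp (2 * c₀) * Real.exp (2 * c₀ * ‖w‖ ^ 2))) := by gcongr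
      _ = Real.exp 1 * ‖theta₀ M c 0‖ * A * Real.exp (2 * c₀) *
            (Real.exp (‖w‖ ^ 2) * Real.exp (2 * c₀ * ‖w‖ ^ 2)) := by ring
      _ ≤ Real.exp 1 * ‖theta₀ M c 0‖ * A * Real.exp (2 * c₀) * X := by gcongr
  have p3 : ‖((M : ℂ))⁻¹ * (Complex.Gamma w)⁻¹‖ ≤ A * X := by
    rw [norm_mul]
    calc ‖(((M : ℂ))⁻¹ : ℂ)‖ * ‖(Complex.Gamma w)⁻¹‖ ≤ 1 * (A * Real.exp (c₀ * ‖w‖ ^ 2)) := by gcongr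
      _ = A * Real.exp (c₀ * ‖w‖ ^ 2) := one_mul _
      _ ≤ A * X := by gcongr
  have hsum : ‖(w - 1) * (cosetPair M c 0).Λ₀ w * (Complex.Gamma w)⁻¹ -
      (w - 1) * theta₀ M c 0 * (Complex.Gamma (w + 1))⁻¹ + ((M : ℂ))⁻¹ * (Complex.Gamma w)⁻¹‖ ≤ K * X := by
    refine (norm_add_le _ _).trans ?_
    refine (add_le_add (norm_sub_le _ _) le_rfl).trans ?_
    rw [hK]
    nlinarith [p1, p2, p3]
  calc ‖cosetZetaE M c w‖
      = ‖(((π / M : ℝ)) : ℂ) ^ w‖ * ‖(w - 1) * (cosetPair M c 0).Λ₀ w * (Complex.Gamma w)⁻¹ -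
          (w - 1) * theta₀ M c 0 * (Complex.Gamma (w + 1))⁻¹ + ((M : ℂ))⁻¹ * (Complex.Gamma w)⁻¹‖ := by
        rw [cosetZetaE, norm_mul]
    _ ≤ E0 * (K * X) := by gcongr
    _ ≤ E0 * (K * (Real.exp (c₁ * S ^ 2) * Real.exp (c₁ ^ 3) * Real.exp (|w.im| ^ (3 : ℝ)))) := by
        have hK0 : 0 ≤ K := by rw [hK]; positivity
        gcongr
    _ = E0 * K * (Real.exp (c₁ * S ^ 2) * Real.exp (c₁ ^ 3)) * Real.exp (|w.im| ^ (3 : ℝ)) := by ring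


/-! ### The convexity bounds (Rademacher–Phragmén–Lindelöf) -/

/-- `L_c` is entire for `k ≥ 1`. [folklore] -/
theorem differentiable_cosetL {k : ℕ} (hk : k ≠ 0) : Differentiable ℂ (cosetL M c k) :=
  (differentiable_cosetZeta hk).comp (differentiable_id.add_const _)

/-- `‖w - 1‖ ≤ ‖w + 2‖` and `‖w + 1‖ ≤ ‖w + 2‖` for `Re w ≥ -1/2`. [folklore] -/
theorem norm_sub_one_le_norm_add_two {w : ℂ} (hw : -1 / 2 ≤ w.re) :
    ‖w - 1‖ ≤ ‖w + 2‖ ∧ ‖w + 1‖ ≤ ‖w + 2‖ := by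
  constructor
  · have h1 : ‖w - 1‖ ^ 2 ≤ ‖w + 2‖ ^ 2 := by
      rw [Complex.sq_norm, Complex.sq_norm, Complex.normSq_apply, Complex.normSq_apply]
      simp; nlinarith
    exact (sq_le_sq₀ (norm_nonneg _) (norm_nonneg _)).mp h1
  · have h1 : ‖w + 1‖ ^ 2 ≤ ‖w + 2‖ ^ 2 := by
      rw [Complex.sq_norm, Complex.sq_norm, Complex.normSq_apply, Complex.normSq_apply]
      simp; nlinarith
    exact (sq_le_sq₀ (norm_nonneg _) (norm_nonneg _)).mp h1

/-- **Uniform convexity bound for `L_c` in the strip** (`k ≥ 1`): for `-1/2 ≤ Re z ≤ 5/2`,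
`‖L_c(z)‖ ≤ M · normSum(3/2) · ‖(k/2 + 1) + z‖²`. Rademacher's theorem on `[-1/2, 5/2]` with
`Q = k/2 + 1`, `α = 2` (left edge), `β = 0` (right edge), growth `exists_norm_cosetL_le_exp`; the
interpolated bound is at most `M normSum X²` (`X = ‖Q + z‖ ≥ 1`, `π⁻² ≤ 1 ≤ M`).
[cite: Rademacher1959, Thm 2] -/
theorem norm_cosetL_le_mul_sq_of_mem_strip {k : ℕ} (hk : k ≠ 0) {z : ℂ} (hz1 : -1 / 2 ≤ z.re)
    (hz2 : z.re ≤ 5 / 2) :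
    ‖cosetL M c k z‖ ≤ ((M : ℝ) * ∑' x : ℤ[i], ((x.norm : ℤ) : ℝ) ^ (-(3 / 2 : ℝ))) *
      ‖((k : ℂ) / 2 + 1) + z‖ ^ 2 := by
  set nS : ℝ := ∑' x : ℤ[i], ((x.norm : ℤ) : ℝ) ^ (-(3 / 2 : ℝ)) with hnSdef
  have hnS : 0 < nS := GaussianHecke.normSum_pos (by norm_num)
  have hM1 : (1 : ℝ) ≤ M := by exact_mod_cast Nat.one_le_iff_ne_zero.mpr (NeZero.ne M)
  have hk0 : (0 : ℝ) ≤ k := Nat.cast_nonneg k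
  have hk1 : (1 : ℝ) ≤ k := by exact_mod_cast Nat.one_le_iff_ne_zero.mpr hk
  set A : ℝ := (M : ℝ) * (π⁻¹ ^ 2 * nS) with hAdef
  have hA : 0 < A := by positivity
  set D : ℝ := (M : ℝ) * nS with hDdef
  have hD : 0 < D := by positivity
  have hAD : A ≤ D := by
    have hπ1 : (1 : ℝ) ≤ π := by linarith [Real.pi_gt_three]
    have h1 : π⁻¹ ^ 2 ≤ 1 := pow_le_one₀ (by positivity) (inv_le_one_of_one_le₀ hπ1)
    calc A = (M : ℝ) * nS * π⁻¹ ^ 2 := by rw [hAdef]; ring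
      _ ≤ (M : ℝ) * nS * 1 := by gcongr
      _ = D := by rw [hDdef, mul_one]
  have hBD : nS ≤ D := by
    calc nS = 1 * nS := (one_mul _).symm
      _ ≤ (M : ℝ) * nS := by gcongr
  obtain ⟨C, hC⟩ := exists_norm_cosetL_le_exp (M := M) (c := c) hk
  set Q : ℝ := (k : ℝ) / 2 + 1 with hQdef
  have hQz : ∀ w : ℂ, (Q : ℂ) + w = ((k : ℂ) / 2 + 1) + w := fun w ↦ by
    rw [hQdef]; push_cast; ring
  have key := Literature.Analysis.Complex.rademacher_phragmenLindelof_of_finiteOrder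
    (f := cosetL M c k) (a := -1 / 2) (b := 5 / 2) (Q := Q) (A := A) (B := nS) (α := 2) (β := 0)
    (C := C) (c := 3) (by norm_num) (by rw [hQdef]; linarith) hA hnS (by norm_num)
    (differentiable_cosetL hk).diffContOnCl (by norm_num)
    (fun w hw1 hw2 ↦ hC w hw1.le hw2.le)
    (fun w hw ↦ by
      rw [hQz w, Real.rpow_two]
      exact norm_cosetL_le_of_re_eq_neg_half k hw)
    (fun w hw ↦ by
      rw [Real.rpow_zero, mul_one]
      exact norm_cosetL_le_of_le_re k (by rw [hw]; norm_num))
    hz1 hz2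
  rw [Real.rpow_zero, mul_one, hQz z, Real.rpow_two] at key
  set X : ℝ := ‖((k : ℂ) / 2 + 1) + z‖ with hXdef
  have hX1 : 1 ≤ X := by
    calc (1 : ℝ) ≤ (((k : ℂ) / 2 + 1) + z).re := by simp; linarith
      _ ≤ X := Complex.re_le_norm _
  have hp : 0 ≤ (5 / 2 - z.re) / (5 / 2 - -1 / 2) := by
    apply div_nonneg <;> linarith
  have hq : 0 ≤ (z.re - -1 / 2) / (5 / 2 - -1 / 2) := by
    apply div_nonneg <;> linarith
  have hpq : (5 / 2 - z.re) / (5 / 2 - -1 / 2) + (z.re - -1 / 2) / (5 / 2 - -1 / 2) = 1 := by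
    field_simp; ring
  have hDX : 0 < D * X ^ 2 := by positivity
  have h1 : A * X ^ 2 ≤ D * X ^ 2 := by gcongr
  have h2 : nS ≤ D * X ^ 2 := hBD.trans (le_mul_of_one_le_right hD.le (one_le_pow₀ hX1))
  calc ‖cosetL M c k z‖
      ≤ (A * X ^ 2) ^ ((5 / 2 - z.re) / (5 / 2 - -1 / 2)) * nS ^ ((z.re - -1 / 2) / (5 / 2 - -1 / 2)) := key
    _ ≤ (D * X ^ 2) ^ ((5 / 2 - z.re) / (5 / 2 - -1 / 2)) *
          (D * X ^ 2) ^ ((z.re - -1 / 2) / (5 / 2 - -1 / 2)) := by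
        apply mul_le_mul
        · exact Real.rpow_le_rpow (by positivity) h1 hp
        · exact Real.rpow_le_rpow hnS.le h2 hq
        · positivity
        · positivity
    _ = D * X ^ 2 := by rw [← Real.rpow_add hDX, hpq, Real.rpow_one]

/-- **`‖L_c(z)‖ ≤ M · normSum(3/2) · ‖(k/2 + 1) + z‖²` on the half-plane `Re z ≥ -1/2`** (`k ≥ 1`;
the strip bound, and the Dirichlet series beyond). [cite: Rademacher1959, Thm 2] -/
theorem norm_cosetL_le_mul_sq {k : ℕ} (hk : k ≠ 0) {z : ℂ} (hz : -1 / 2 ≤ z.re) :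
    ‖cosetL M c k z‖ ≤ ((M : ℝ) * ∑' x : ℤ[i], ((x.norm : ℤ) : ℝ) ^ (-(3 / 2 : ℝ))) *
      ‖((k : ℂ) / 2 + 1) + z‖ ^ 2 := by
  rcases le_or_gt z.re (5 / 2) with h | h
  · exact norm_cosetL_le_mul_sq_of_mem_strip hk hz h
  · have hnS : 0 < ∑' x : ℤ[i], ((x.norm : ℤ) : ℝ) ^ (-(3 / 2 : ℝ)) :=
      GaussianHecke.normSum_pos (by norm_num)
    have hM1 : (1 : ℝ) ≤ M := by exact_mod_cast Nat.one_le_iff_ne_zero.mpr (NeZero.ne M)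
    have hk0 : (0 : ℝ) ≤ k := Nat.cast_nonneg k
    have hX1 : 1 ≤ ‖((k : ℂ) / 2 + 1) + z‖ := by
      calc (1 : ℝ) ≤ (((k : ℂ) / 2 + 1) + z).re := by simp; linarith
        _ ≤ ‖((k : ℂ) / 2 + 1) + z‖ := Complex.re_le_norm _
    calc ‖cosetL M c k z‖ ≤ ∑' x : ℤ[i], ((x.norm : ℤ) : ℝ) ^ (-(3 / 2 : ℝ)) :=
          norm_cosetL_le_of_le_re k (by linarith)
      _ = 1 * (∑' x : ℤ[i], ((x.norm : ℤ) : ℝ) ^ (-(3 / 2 : ℝ))) * 1 := by ring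
      _ ≤ (M : ℝ) * (∑' x : ℤ[i], ((x.norm : ℤ) : ℝ) ^ (-(3 / 2 : ℝ))) *
            ‖((k : ℂ) / 2 + 1) + z‖ ^ 2 := by
          gcongr
          exact one_le_pow₀ hX1

/-- `cosetL M c 0 = cosetZeta M c 0`. [folklore] -/
theorem cosetL_zero_eq (w : ℂ) : cosetL M c 0 w = cosetZeta M c 0 w := by
  simp [cosetL]

/-- **Uniform convexity bound for `E_c` in the strip**: for `-1/2 ≤ Re z ≤ 5/2`,
`‖E_c(z)‖ ≤ M · normSum(3/2) · ‖2 + z‖³` (Rademacher with `Q = 2`, `α = 3`, `β = 1`: on the left edge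
`‖E_c‖ = ‖z - 1‖ ‖Z_0‖ ≤ Mπ⁻² normSum ‖2 + z‖³`, on the right edge `‖E_c‖ ≤ normSum ‖2 + z‖`).
[cite: Rademacher1959, Thm 2] -/
theorem norm_cosetZetaE_le_of_mem_strip {z : ℂ} (hz1 : -1 / 2 ≤ z.re) (hz2 : z.re ≤ 5 / 2) :
    ‖cosetZetaE M c z‖ ≤ ((M : ℝ) * ∑' x : ℤ[i], ((x.norm : ℤ) : ℝ) ^ (-(3 / 2 : ℝ))) *
      ‖(2 : ℂ) + z‖ ^ 3 := by
  set nS : ℝ := ∑' x : ℤ[i], ((x.norm : ℤ) : ℝ) ^ (-(3 / 2 : ℝ)) with hnSdef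
  have hnS : 0 < nS := GaussianHecke.normSum_pos (by norm_num)
  have hM1 : (1 : ℝ) ≤ M := by exact_mod_cast Nat.one_le_iff_ne_zero.mpr (NeZero.ne M)
  set A : ℝ := (M : ℝ) * (π⁻¹ ^ 2 * nS) with hAdef
  have hA : 0 < A := by positivity
  set D : ℝ := (M : ℝ) * nS with hDdef
  have hD : 0 < D := by positivity
  have hAD : A ≤ D := by
    have hπ1 : (1 : ℝ) ≤ π := by linarith [Real.pi_gt_three]
    have h1 : π⁻¹ ^ 2 ≤ 1 := pow_le_one₀ (by positivity) (inv_le_one_of_one_le₀ hπ1)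
    calc A = (M : ℝ) * nS * π⁻¹ ^ 2 := by rw [hAdef]; ring
      _ ≤ (M : ℝ) * nS * 1 := by gcongr
      _ = D := by rw [hDdef, mul_one]
  have hBD : nS ≤ D := by
    calc nS = 1 * nS := (one_mul _).symm
      _ ≤ (M : ℝ) * nS := by gcongr
  obtain ⟨C, hC⟩ := exists_norm_cosetZetaE_le_exp (M := M) (c := c)
  have hQz : ∀ w : ℂ, ((2 : ℝ) : ℂ) + w = (2 : ℂ) + w := fun w ↦ by push_cast; ring
  -- the two edges
  have hleft : ∀ w : ℂ, w.re = -1 / 2 → ‖cosetZetaE M c w‖ ≤ A * ‖(2 : ℂ) + w‖ ^ 3 := by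
    intro w hw
    have hw0 : w ≠ 0 := fun h ↦ by rw [h, zero_re] at hw; norm_num at hw
    have hw1 : w ≠ 1 := fun h ↦ by rw [h, one_re] at hw; norm_num at hw
    have hZ := norm_cosetL_le_of_re_eq_neg_half (M := M) (c := c) 0 hw
    rw [cosetL_zero_eq, Nat.cast_zero, zero_div, zero_add] at hZ
    obtain ⟨ha, hb⟩ := norm_sub_one_le_norm_add_two (le_of_eq hw.symm)
    rw [add_comm w 2] at ha hb
    rw [add_comm (1 : ℂ) w, ← hAdef] at hZ
    have hb' := hb
    rw [add_comm w 1] at hb'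
    calc ‖cosetZetaE M c w‖ = ‖w - 1‖ * ‖cosetZeta M c 0 w‖ := by rw [cosetZetaE_eq hw0 hw1, norm_mul]
      _ ≤ ‖(2 : ℂ) + w‖ * (A * ‖w + 1‖ ^ 2) := by gcongr
      _ ≤ ‖(2 : ℂ) + w‖ * (A * ‖(2 : ℂ) + w‖ ^ 2) := by gcongr
      _ = A * ‖(2 : ℂ) + w‖ ^ 3 := by ring
  have hright : ∀ w : ℂ, w.re = 5 / 2 → ‖cosetZetaE M c w‖ ≤ nS * ‖(2 : ℂ) + w‖ ^ (1 : ℝ) := by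
    intro w hw
    have hw0 : w ≠ 0 := fun h ↦ by rw [h, zero_re] at hw; norm_num at hw
    have hw1 : w ≠ 1 := fun h ↦ by rw [h, one_re] at hw; norm_num at hw
    have hZ := norm_cosetL_le_of_le_re (M := M) (c := c) 0 (by rw [hw]; norm_num : (3 : ℝ) / 2 ≤ w.re)
    rw [cosetL_zero_eq] at hZ
    obtain ⟨ha, _⟩ := norm_sub_one_le_norm_add_two (by rw [hw]; norm_num : -1 / 2 ≤ w.re)
    rw [add_comm w 2] at ha
    rw [Real.rpow_one]
    calc ‖cosetZetaE M c w‖ = ‖w - 1‖ * ‖cosetZeta M c 0 w‖ := by rw [cosetZetaE_eq hw0 hw1, norm_mul]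
      _ ≤ ‖(2 : ℂ) + w‖ * nS := by gcongr
      _ = nS * ‖(2 : ℂ) + w‖ := mul_comm _ _
  have key := Literature.Analysis.Complex.rademacher_phragmenLindelof_of_finiteOrder
    (f := cosetZetaE M c) (a := -1 / 2) (b := 5 / 2) (Q := 2) (A := A) (B := nS) (α := 3) (β := 1)
    (C := C) (c := 3) (by norm_num) (by norm_num) hA hnS (by norm_num)
    differentiable_cosetZetaE.diffContOnCl (by norm_num)
    (fun w hw1 hw2 ↦ hC w hw1.le hw2.le)
    (fun w hw ↦ by
      rw [hQz w, show ((3 : ℝ)) = ((3 : ℕ) : ℝ) by norm_num, Real.rpow_natCast]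
      exact hleft w hw)
    (fun w hw ↦ by rw [hQz w]; exact hright w hw)
    hz1 hz2
  rw [hQz z, Real.rpow_one, show ((3 : ℝ)) = ((3 : ℕ) : ℝ) by norm_num, Real.rpow_natCast] at key
  set X : ℝ := ‖(2 : ℂ) + z‖ with hXdef
  have hX1 : 1 ≤ X := by
    calc (1 : ℝ) ≤ ((2 : ℂ) + z).re := by simp; linarith
      _ ≤ X := Complex.re_le_norm _
  have hp : 0 ≤ (5 / 2 - z.re) / (5 / 2 - -1 / 2) := by
    apply div_nonneg <;> linarith
  have hq : 0 ≤ (z.re - -1 / 2) / (5 / 2 - -1 / 2) := by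
    apply div_nonneg <;> linarith
  have hpq : (5 / 2 - z.re) / (5 / 2 - -1 / 2) + (z.re - -1 / 2) / (5 / 2 - -1 / 2) = 1 := by
    field_simp; ring
  have hDX : 0 < D * X ^ 3 := by positivity
  have h1 : A * X ^ 3 ≤ D * X ^ 3 := by gcongr
  have h2 : nS * X ≤ D * X ^ 3 := by
    have hX3 : X ≤ X ^ 3 := by
      calc X = X ^ 1 := (pow_one X).symm
        _ ≤ X ^ 3 := pow_le_pow_right₀ hX1 (by norm_num)
    exact mul_le_mul hBD hX3 (by positivity) hD.le
  calc ‖cosetZetaE M c z‖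
      ≤ (A * X ^ 3) ^ ((5 / 2 - z.re) / (5 / 2 - -1 / 2)) * (nS * X) ^ ((z.re - -1 / 2) / (5 / 2 - -1 / 2)) := key
    _ ≤ (D * X ^ 3) ^ ((5 / 2 - z.re) / (5 / 2 - -1 / 2)) *
          (D * X ^ 3) ^ ((z.re - -1 / 2) / (5 / 2 - -1 / 2)) := by
        apply mul_le_mul
        · exact Real.rpow_le_rpow (by positivity) h1 hp
        · exact Real.rpow_le_rpow (by positivity) h2 hq
        · positivity
        · positivity
    _ = D * X ^ 3 := by rw [← Real.rpow_add hDX, hpq, Real.rpow_one]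

/-- **`‖E_c(z)‖ ≤ M · normSum(3/2) · ‖2 + z‖³` on the half-plane `Re z ≥ -1/2`** (the strip bound, and
`E_c = (z - 1) Z_0` with the Dirichlet series beyond). [cite: Rademacher1959, Thm 2] -/
theorem norm_cosetZetaE_le {z : ℂ} (hz : -1 / 2 ≤ z.re) :
    ‖cosetZetaE M c z‖ ≤ ((M : ℝ) * ∑' x : ℤ[i], ((x.norm : ℤ) : ℝ) ^ (-(3 / 2 : ℝ))) *
      ‖(2 : ℂ) + z‖ ^ 3 := by
  rcases le_or_gt z.re (5 / 2) with h | h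
  · exact norm_cosetZetaE_le_of_mem_strip hz h
  · set nS : ℝ := ∑' x : ℤ[i], ((x.norm : ℤ) : ℝ) ^ (-(3 / 2 : ℝ)) with hnSdef
    have hnS : 0 < nS := GaussianHecke.normSum_pos (by norm_num)
    have hM1 : (1 : ℝ) ≤ M := by exact_mod_cast Nat.one_le_iff_ne_zero.mpr (NeZero.ne M)
    have hz0 : z ≠ 0 := fun h' ↦ by rw [h', zero_re] at h; norm_num at h
    have hz1 : z ≠ 1 := fun h' ↦ by rw [h', one_re] at h; norm_num at h
    have hZ := norm_cosetL_le_of_le_re (M := M) (c := c) 0 (by linarith : (3 : ℝ) / 2 ≤ z.re)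
    rw [cosetL_zero_eq] at hZ
    obtain ⟨ha, _⟩ := norm_sub_one_le_norm_add_two hz
    rw [add_comm z 2] at ha
    have hX1 : 1 ≤ ‖(2 : ℂ) + z‖ := by
      calc (1 : ℝ) ≤ ((2 : ℂ) + z).re := by simp; linarith
        _ ≤ ‖(2 : ℂ) + z‖ := Complex.re_le_norm _
    calc ‖cosetZetaE M c z‖ = ‖z - 1‖ * ‖cosetZeta M c 0 z‖ := by rw [cosetZetaE_eq hz0 hz1, norm_mul]
      _ ≤ ‖(2 : ℂ) + z‖ * nS := by gcongr
      _ = 1 * nS * ‖(2 : ℂ) + z‖ ^ 1 := by ring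
      _ ≤ (M : ℝ) * nS * ‖(2 : ℂ) + z‖ ^ 3 := by
          have h3 : ‖(2 : ℂ) + z‖ ^ 1 ≤ ‖(2 : ℂ) + z‖ ^ 3 := pow_le_pow_right₀ hX1 (by norm_num)
          exact mul_le_mul (mul_le_mul_of_nonneg_right hM1 hnS.le) h3 (by positivity) (by positivity)

/-- **Existential packaging of the bounds**, uniform in the modulus `M ≥ 1`, the coset `c`, and the
weight `k`: an absolute `D > 0` with (i) `‖L_c(z)‖ ≤ D M ‖(k/2+1) + z‖²` for `k ≥ 1`, `Re z ≥ -1/2`;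
(ii) `‖E_c(z)‖ ≤ D M ‖2 + z‖³` for `Re z ≥ -1/2` (`E_c = (z-1)Z_0`); (iii) `‖L_c(z)‖ ≤ D` for
`Re z ≥ 3/2` (all `k`). This is the input of the polynomial bounds (16.18)–(16.19) for the Hecke
`L`-functions `L(s, ψ)` modulo `4d` of Friedlander–Iwaniec. [cite: FriedlanderIwaniecAnnals1998, (16.18)] -/
theorem exists_coset_bounds :
    ∃ D : ℝ, 0 < D ∧
      (∀ (M : ℕ) [NeZero M] (c : ℤ[i]) (k : ℕ), k ≠ 0 → ∀ z : ℂ, -1 / 2 ≤ z.re →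
        ‖cosetL M c k z‖ ≤ D * M * ‖((k : ℂ) / 2 + 1) + z‖ ^ 2) ∧
      (∀ (M : ℕ) [NeZero M] (c : ℤ[i]) (z : ℂ), -1 / 2 ≤ z.re →
        ‖cosetZetaE M c z‖ ≤ D * M * ‖(2 : ℂ) + z‖ ^ 3) ∧
      (∀ (M : ℕ) [NeZero M] (c : ℤ[i]) (k : ℕ) (z : ℂ), 3 / 2 ≤ z.re → ‖cosetL M c k z‖ ≤ D) := by
  refine ⟨∑' x : ℤ[i], ((x.norm : ℤ) : ℝ) ^ (-(3 / 2 : ℝ)), GaussianHecke.normSum_pos (by norm_num),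
    fun M _ c k hk z hz ↦ ?_, fun M _ c z hz ↦ ?_, fun M _ c k z hz ↦ norm_cosetL_le_of_le_re k hz⟩
  · have := norm_cosetL_le_mul_sq (M := M) (c := c) hk hz
    linarith [this]
  · have := norm_cosetZetaE_le (M := M) (c := c) hz
    linarith [this]

end GaussianCosetTheta

end Literature.NumberTheory.LFunctions
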